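import Mathlib
import HarnessLib

/-!
# Route RootDecompLitSlice — cell Uᶜ `CritTameScarIsCritical` (stmt-NavierStokesRegularity-31733):
# the MEAN-FIELD BOOTSTRAP MAP `Ψ(a) = (5+2a)/(4(5−4a))` of the energy exponent on the √-clock class
# (pure real analysis: fixed-point dynamics, exponent bookkeeping of the one-step estimate, abstract iteration)

Helpers toward Uᶜ (`--supports 31733`, no item, no node); companion module
`RootDecompLitSliceMeanFieldBootstrap` draws the consequences on Uᶜ's frame. Frame of Uᶜ: a maximal smooth
solution on `[0,T)`, Leray–Hopf on `[0,T]`, rapidly decaying datum, TAME at `T` with the CRITICAL CLOCK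
`∫|u(t)−u(T)|² ≤ K√(T−t)`; `τ = T − t`, `D(t) = ‖u(t)‖₂² − ‖u(T)‖₂² = 2ν∫_t^T‖∇u‖₂²`. The landed energy–clock
scar law (`EnergyClockScarLaw.energyClockScarRung`, clock `b = 1/2`, energy law `D ≤ Cτ^a`) gives terminal
scars of order `α(a) = 1/(3/2 − a)`; `a = 1/4` is free (`energyLaw_of_clock`), `a = 1/2` is Uᶜ.

THE MEAN-FIELD LEVER (paper-level one-step estimate, decomp-ns writer g43). `D = ‖w‖² + 2⟨w, u(T)⟩`,
`w = u(t) − u(T)`; replace the gradient-less trace `u(T)` by an `H¹` PROXY `ū = u(s)`, `s ∈ (T−σ, T)` a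
Chebyshev slice (`‖∇ū‖₂² ≤ D(T−σ)/(2νσ)`, `‖u(T) − ū‖₂ ≤ √K σ^{1/4}`); test Navier–Stokes against the FIXED
smooth divergence-free field `ū` (pressure drops; trilinear antisymmetry `⟨(v·∇)ū, ū⟩ = 0`; `Ḣ¹ ⊂ L⁶`;
Hölder in time). Under the energy law `a` and with `σ = τ^μ` the four terms have exponents
`e1 = 1/4 + μ/4` (trace minus proxy), `e2a = (1+3a)/4 + μ(1/8 − (1−a)/2)` and
`e2b = (1+a)/2 + μ(1/8 − 3(1−a)/4)` (trilinear), `e3 = (1+a)/2 − μ(1−a)/2` (viscous), and at the balance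
`μ⋆ = 6a/(5−4a)` the new exponent is `Ψ(a)`.

KERNEL CONTENT (def-free, `Mathlib` only):
* §1 `Ψ`-algebra: `a < Ψ(a) < 1/2` for `a < 1/2`, `1/2 − Ψ(a) ≤ (5/6)(1/2 − a)`, fixed points `{1/2, 5/8}` — the
  endpoint `1/2` is ATTRACTING from below and never reached; `Ψ(1/4) = 11/32`, first-step scar `32/37 > 16/19`.
* §2 exponent bookkeeping at `μ⋆` (`e1 = e2a = Ψ`, `Ψ ≤ e2b`, `Ψ ≤ e3`, `Ψ ≤ 1/2`, `0 < μ⋆ ≤ 1`) and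
  `step_of_termBounds`: the four term bounds ⟹ `D ≤ C'τ^{Ψ(a)}` on `τ ≤ 1`.
* §3 `all_lt_half_of_step`: base `a = 1/4` + one-step `P a → P (Ψ a)` on `[1/4,1/2)` + downward closure ⟹
  `P a` for EVERY `a < 1/2` (gap contraction `(5/6)^n`); `powerLaw_mono` (downward closure of terminal power laws).

HONEST FRAMING: arithmetic of a conditional face INSIDE the Tao-vacuous, zero-load cell Uᶜ; no item, no node,
no load of any route moves (ROOT ⟺ Uᵃ ∧ P1, critic rows 354/371/698/717). Rung 0: nothing here proves NS
regularity. [folklore]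
-/

set_option linter.dupNamespace false

namespace Summit.NavierStokesRegularity.NavierStokesRegularity.Theorems

open MeasureTheory Set Filter Topology
open scoped ENNReal

namespace MeanFieldBootstrap

/-! ### §1 The bootstrap map `Ψ(a) = (5+2a)/(4(5−4a))` -/

/-- `Ψ(a) − a = (1−2a)(5−8a)/(4(5−4a))`. [folklore] -/
theorem psi_sub_self {a : ℝ} (ha : a < 5 / 4) :
    (5 + 2 * a) / (4 * (5 - 4 * a)) - a = (1 - 2 * a) * (5 - 8 * a) / (4 * (5 - 4 * a)) := by
  have h : (5 : ℝ) - 4 * a ≠ 0 := by intro h; linarith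
  obtain ⟨i, hi⟩ : ∃ i : ℝ, i = (5 - 4 * a)⁻¹ := ⟨_, rfl⟩
  have hdi : (5 - 4 * a) * i = 1 := by rw [hi]; exact mul_inv_cancel₀ h
  simp only [div_eq_mul_inv, mul_inv, ← hi]
  linear_combination a * hdi

/-- `1/2 − Ψ(a) = 5(1−2a)/(4(5−4a)) = (1/2 − a) · 5/(2(5−4a))`: the gap to the endpoint contracts by the
factor `5/(2(5−4a)) ∈ [5/8, 5/6]` on `[1/4, 1/2]`. [folklore] -/
theorem half_sub_psi {a : ℝ} (ha : a < 5 / 4) :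
    1 / 2 - (5 + 2 * a) / (4 * (5 - 4 * a)) = 5 * (1 - 2 * a) / (4 * (5 - 4 * a)) := by
  have h : (5 : ℝ) - 4 * a ≠ 0 := by intro h; linarith
  obtain ⟨i, hi⟩ : ∃ i : ℝ, i = (5 - 4 * a)⁻¹ := ⟨_, rfl⟩
  have hdi : (5 - 4 * a) * i = 1 := by rw [hi]; exact mul_inv_cancel₀ h
  simp only [div_eq_mul_inv, mul_inv, ← hi]
  linear_combination (-1 / 2 : ℝ) * hdi

/-- `Ψ` moves every sub-endpoint exponent strictly up: `a < Ψ(a)` for `a < 1/2`. [folklore] -/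
theorem lt_psi {a : ℝ} (ha : a < 1 / 2) : a < (5 + 2 * a) / (4 * (5 - 4 * a)) := by
  have hpos : (0 : ℝ) < 4 * (5 - 4 * a) := by linarith
  rw [lt_div_iff₀ hpos]
  nlinarith [mul_pos (show (0 : ℝ) < 1 - 2 * a by linarith) (show (0 : ℝ) < 5 - 8 * a by linarith)]

/-- `Ψ` never reaches the endpoint: `Ψ(a) < 1/2` for `a < 1/2`. [folklore] -/
theorem psi_lt_half {a : ℝ} (ha : a < 1 / 2) : (5 + 2 * a) / (4 * (5 - 4 * a)) < 1 / 2 := by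
  have hpos : (0 : ℝ) < 4 * (5 - 4 * a) := by linarith
  rw [div_lt_iff₀ hpos]
  linarith

/-- Geometric contraction of the gap: `1/2 − Ψ(a) ≤ (5/6)(1/2 − a)` for `a ≤ 1/2` (`Ψ'(1/2) = 5/6`). [folklore] -/
theorem half_sub_psi_le {a : ℝ} (ha : a ≤ 1 / 2) :
    1 / 2 - (5 + 2 * a) / (4 * (5 - 4 * a)) ≤ 5 / 6 * (1 / 2 - a) := by
  have hpos : (0 : ℝ) < 4 * (5 - 4 * a) := by linarith
  have h : (5 : ℝ) - 4 * a ≠ 0 := by intro h; linarith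
  have hrw : 1 / 2 - (5 + 2 * a) / (4 * (5 - 4 * a)) = (2 * (5 - 4 * a) - (5 + 2 * a)) / (4 * (5 - 4 * a)) := by
    obtain ⟨i, hi⟩ : ∃ i : ℝ, i = (5 - 4 * a)⁻¹ := ⟨_, rfl⟩
    have hdi : (5 - 4 * a) * i = 1 := by rw [hi]; exact mul_inv_cancel₀ h
    simp only [div_eq_mul_inv, mul_inv, ← hi]
    linear_combination (-1 / 2 : ℝ) * hdi
  rw [hrw, div_le_iff₀ hpos]
  nlinarith [sq_nonneg (1 - 2 * a), hpos]

/-- `Ψ` preserves the strip `[1/4, 1/2)` from below: `1/4 ≤ a < 1/2 ⟹ 1/4 ≤ Ψ(a)`. [folklore] -/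
theorem quarter_le_psi {a : ℝ} (h1 : 1 / 4 ≤ a) (h2 : a < 1 / 2) :
    1 / 4 ≤ (5 + 2 * a) / (4 * (5 - 4 * a)) :=
  h1.trans (lt_psi h2).le

/-- The `5/8` and `1/2` fixed points: `Ψ(a) = a ↔ a = 1/2 ∨ a = 5/8` (`a < 5/4`). [folklore] -/
theorem psi_eq_self_iff {a : ℝ} (ha : a < 5 / 4) :
    (5 + 2 * a) / (4 * (5 - 4 * a)) = a ↔ a = 1 / 2 ∨ a = 5 / 8 := by
  have h : (5 : ℝ) - 4 * a ≠ 0 := by intro h; linarith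
  have h4 : (4 : ℝ) * (5 - 4 * a) ≠ 0 := mul_ne_zero (by norm_num) h
  constructor
  · intro heq
    have h2 : (1 - 2 * a) * (5 - 8 * a) = 0 := by
      have := psi_sub_self ha
      rw [heq, sub_self] at this
      have := (div_eq_zero_iff.1 this.symm).resolve_right h4
      linarith [this]
    rcases mul_eq_zero.1 h2 with h3 | h3
    · left; linarith
    · right; linarith
  · rintro (rfl | rfl) <;> norm_num

/-- First iterate: `Ψ(1/4) = 11/32` (balance `μ⋆ = 3/8`). [folklore] -/
theorem psi_quarter : (5 + 2 * (1 / 4 : ℝ)) / (4 * (5 - 4 * (1 / 4))) = 11 / 32 := by norm_num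

/-- Scar order after the first step: `α(11/32) = 1/(3/2 − 11/32) = 32/37 (> 16/19)`. [folklore] -/
theorem scar_first_step : 2 * (1 / 2 : ℝ) / (1 + 1 / 2 - 11 / 32) = 32 / 37 ∧ (16 : ℝ) / 19 < 32 / 37 := by
  constructor <;> norm_num

/-! ### §2 Exponent bookkeeping of the one-step estimate at the balance `μ⋆ = 6a/(5−4a)` -/

/-- The balance point lies in `(0, 1]` exactly on the strip: `0 < a ≤ 1/2 ⟹ 0 < μ⋆ ≤ 1` (so `σ = τ^{μ⋆} ≥ τ`
for `τ ≤ 1`). [folklore] -/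
theorem muStar_mem {a : ℝ} (h0 : 0 < a) (h2 : a ≤ 1 / 2) :
    0 < 6 * a / (5 - 4 * a) ∧ 6 * a / (5 - 4 * a) ≤ 1 := by
  have hpos : (0 : ℝ) < 5 - 4 * a := by linarith
  refine ⟨div_pos (by linarith) hpos, ?_⟩
  rw [div_le_iff₀ hpos]
  linarith

/-- Term T1 (trace minus proxy, Cauchy–Schwarz × two clocks): `e1(μ⋆) = 1/4 + μ⋆/4 = Ψ(a)`. [folklore] -/
theorem e1_eq_psi {a : ℝ} (ha : a < 5 / 4) :
    1 / 4 + 6 * a / (5 - 4 * a) / 4 = (5 + 2 * a) / (4 * (5 - 4 * a)) := by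
  have h : (5 : ℝ) - 4 * a ≠ 0 := by intro h; linarith
  obtain ⟨i, hi⟩ : ∃ i : ℝ, i = (5 - 4 * a)⁻¹ := ⟨_, rfl⟩
  have hdi : (5 - 4 * a) * i = 1 := by rw [hi]; exact mul_inv_cancel₀ h
  simp only [div_eq_mul_inv, mul_inv, ← hi]
  linear_combination (-1 / 4 : ℝ) * hdi

/-- Term T2a (trilinear, `‖∇u‖^{3/2}` branch): `e2a(μ⋆) = (1+3a)/4 + μ⋆(1/8 − (1−a)/2) = Ψ(a)`. [folklore] -/
theorem e2a_eq_psi {a : ℝ} (ha : a < 5 / 4) :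
    (1 + 3 * a) / 4 + 6 * a / (5 - 4 * a) * (1 / 8 - (1 - a) / 2) = (5 + 2 * a) / (4 * (5 - 4 * a)) := by
  have h : (5 : ℝ) - 4 * a ≠ 0 := by intro h; linarith
  obtain ⟨i, hi⟩ : ∃ i : ℝ, i = (5 - 4 * a)⁻¹ := ⟨_, rfl⟩
  have hdi : (5 - 4 * a) * i = 1 := by rw [hi]; exact mul_inv_cancel₀ h
  simp only [div_eq_mul_inv, mul_inv, ← hi]
  linear_combination (-(1 + 3 * a) / 4 : ℝ) * hdi

/-- Term T2b (trilinear, `‖∇ū‖^{3/2}` branch): `e2b(μ⋆) − Ψ(a) = 10(1−a)(1−2a)/(8(5−4a)) ≥ 0` on `a ≤ 1/2`.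
[folklore] -/
theorem psi_le_e2b {a : ℝ} (ha : a ≤ 1 / 2) :
    (5 + 2 * a) / (4 * (5 - 4 * a)) ≤ (1 + a) / 2 + 6 * a / (5 - 4 * a) * (1 / 8 - 3 * (1 - a) / 4) := by
  have hpos : (0 : ℝ) < 5 - 4 * a := by linarith
  have h : (5 : ℝ) - 4 * a ≠ 0 := hpos.ne'
  have hrw : (1 + a) / 2 + 6 * a / (5 - 4 * a) * (1 / 8 - 3 * (1 - a) / 4) - (5 + 2 * a) / (4 * (5 - 4 * a)) =
      10 * (1 - a) * (1 - 2 * a) / (8 * (5 - 4 * a)) := by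
    obtain ⟨i, hi⟩ : ∃ i : ℝ, i = (5 - 4 * a)⁻¹ := ⟨_, rfl⟩
    have hdi : (5 - 4 * a) * i = 1 := by rw [hi]; exact mul_inv_cancel₀ h
    simp only [div_eq_mul_inv, mul_inv, ← hi]
    linear_combination (-(1 + a) / 2 : ℝ) * hdi
  have hnn : 0 ≤ 10 * (1 - a) * (1 - 2 * a) / (8 * (5 - 4 * a)) :=
    div_nonneg (mul_nonneg (mul_nonneg (by norm_num) (by linarith)) (by linarith)) (by linarith)
  linarith [hrw, hnn]

/-- Term T3 (viscous, Cauchy–Schwarz in time): `e3(μ⋆) − Ψ(a) = (1−2a)(5−2a)/(4(5−4a)) ≥ 0` on `a ≤ 1/2`.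
[folklore] -/
theorem psi_le_e3 {a : ℝ} (ha : a ≤ 1 / 2) :
    (5 + 2 * a) / (4 * (5 - 4 * a)) ≤ (1 + a) / 2 - 6 * a / (5 - 4 * a) * ((1 - a) / 2) := by
  have hpos : (0 : ℝ) < 5 - 4 * a := by linarith
  have h : (5 : ℝ) - 4 * a ≠ 0 := hpos.ne'
  have hrw : (1 + a) / 2 - 6 * a / (5 - 4 * a) * ((1 - a) / 2) - (5 + 2 * a) / (4 * (5 - 4 * a)) =
      (1 - 2 * a) * (5 - 2 * a) / (4 * (5 - 4 * a)) := by
    obtain ⟨i, hi⟩ : ∃ i : ℝ, i = (5 - 4 * a)⁻¹ := ⟨_, rfl⟩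
    have hdi : (5 - 4 * a) * i = 1 := by rw [hi]; exact mul_inv_cancel₀ h
    simp only [div_eq_mul_inv, mul_inv, ← hi]
    linear_combination (-(1 + a) / 2 : ℝ) * hdi
  have hnn : 0 ≤ (1 - 2 * a) * (5 - 2 * a) / (4 * (5 - 4 * a)) :=
    div_nonneg (mul_nonneg (by linarith) (by linarith)) (by linarith)
  linarith [hrw, hnn]

/-- The clock term itself: `Ψ(a) ≤ 1/2` for `a ≤ 1/2`. [folklore] -/
theorem psi_le_half {a : ℝ} (ha : a ≤ 1 / 2) : (5 + 2 * a) / (4 * (5 - 4 * a)) ≤ 1 / 2 := by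
  have hpos : (0 : ℝ) < 4 * (5 - 4 * a) := by linarith
  rw [div_le_iff₀ hpos]
  linarith

/-- **The one-step estimate from its four term bounds** (kernel form of the exponent bookkeeping): if near `T`
`D(t) ≤ K τ^{1/2} + A₁ τ^{e1} + A₂ τ^{e2a} + A₃ τ^{e2b} + A₄ τ^{e3}` with the exponents taken at the balance
`μ⋆ = 6a/(5−4a)`, `a ∈ (0, 1/2]`, nonnegative constants, then `D(t) ≤ (K + A₁ + A₂ + A₃ + A₄) τ^{Ψ(a)}` for
`τ = T − t ≤ 1`. [folklore] -/
theorem step_of_termBounds {T a K A₁ A₂ A₃ A₄ : ℝ} {D : ℝ → ℝ} (h0 : 0 < a) (ha : a ≤ 1 / 2)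
    (hK : 0 ≤ K) (hA₁ : 0 ≤ A₁) (hA₂ : 0 ≤ A₂) (hA₃ : 0 ≤ A₃) (hA₄ : 0 ≤ A₄) {T₂ : ℝ} (hT₂ : T₂ < T)
    (hD : ∀ t ∈ Ioo T₂ T, D t ≤ K * (T - t) ^ (1 / 2 : ℝ)
      + A₁ * (T - t) ^ (1 / 4 + 6 * a / (5 - 4 * a) / 4)
      + A₂ * (T - t) ^ ((1 + 3 * a) / 4 + 6 * a / (5 - 4 * a) * (1 / 8 - (1 - a) / 2))
      + A₃ * (T - t) ^ ((1 + a) / 2 + 6 * a / (5 - 4 * a) * (1 / 8 - 3 * (1 - a) / 4))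
      + A₄ * (T - t) ^ ((1 + a) / 2 - 6 * a / (5 - 4 * a) * ((1 - a) / 2))) :
    ∃ C T₃ : ℝ, T₃ < T ∧ ∀ t ∈ Ioo T₃ T, D t ≤ C * (T - t) ^ ((5 + 2 * a) / (4 * (5 - 4 * a))) := by
  have ha' : a < 5 / 4 := by linarith
  refine ⟨K + A₁ + A₂ + A₃ + A₄, max T₂ (T - 1), max_lt hT₂ (by linarith), fun t ht => ?_⟩
  have hT₂t : T₂ < t := lt_of_le_of_lt (le_max_left _ _) ht.1
  have ht1 : T - 1 < t := lt_of_le_of_lt (le_max_right _ _) ht.1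
  have hτ0 : 0 < T - t := by linarith [ht.2]
  have hτ1 : T - t ≤ 1 := by linarith
  set ψ : ℝ := (5 + 2 * a) / (4 * (5 - 4 * a)) with hψ
  -- every exponent is ≥ ψ, so every power is ≤ τ^ψ on τ ≤ 1
  have hmono : ∀ e : ℝ, ψ ≤ e → (T - t) ^ e ≤ (T - t) ^ ψ := fun e he =>
    Real.rpow_le_rpow_of_exponent_ge hτ0 hτ1 he
  have h1 := hmono _ (psi_le_half ha)
  have h2 := hmono _ (le_of_eq (e1_eq_psi ha').symm)
  have h3 := hmono _ (le_of_eq (e2a_eq_psi ha').symm)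
  have h4 := hmono _ (psi_le_e2b ha)
  have h5 := hmono _ (psi_le_e3 ha)
  have := hD t ⟨hT₂t, ht.2⟩
  nlinarith [mul_le_mul_of_nonneg_left h1 hK, mul_le_mul_of_nonneg_left h2 hA₁,
    mul_le_mul_of_nonneg_left h3 hA₂, mul_le_mul_of_nonneg_left h4 hA₃, mul_le_mul_of_nonneg_left h5 hA₄]

/-! ### §3 The abstract iteration: base + one-step + monotonicity ⟹ every `a < 1/2` -/

/-- `n` bootstrap steps from `a₀ = 1/4` reach an exponent `b ∈ [1/4, 1/2)` with `1/2 − b ≤ (5/6)^n/4`.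
[folklore] -/
theorem iterate_psi {P : ℝ → Prop} (base : P (1 / 4))
    (step : ∀ a : ℝ, 1 / 4 ≤ a → a < 1 / 2 → P a → P ((5 + 2 * a) / (4 * (5 - 4 * a)))) :
    ∀ n : ℕ, ∃ b : ℝ, 1 / 4 ≤ b ∧ b < 1 / 2 ∧ 1 / 2 - b ≤ (5 / 6 : ℝ) ^ n * (1 / 4) ∧ P b := by
  intro n
  induction n with
  | zero => exact ⟨1 / 4, le_rfl, by norm_num, by norm_num, base⟩
  | succ n ih =>
    obtain ⟨b, hb1, hb2, hb3, hPb⟩ := ih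
    refine ⟨(5 + 2 * b) / (4 * (5 - 4 * b)), quarter_le_psi hb1 hb2, psi_lt_half hb2, ?_,
      step b hb1 hb2 hPb⟩
    calc 1 / 2 - (5 + 2 * b) / (4 * (5 - 4 * b)) ≤ 5 / 6 * (1 / 2 - b) := half_sub_psi_le hb2.le
      _ ≤ 5 / 6 * ((5 / 6 : ℝ) ^ n * (1 / 4)) := by gcongr
      _ = (5 / 6 : ℝ) ^ (n + 1) * (1 / 4) := by ring

/-- ★ **Bootstrap principle**: a property of exponents holding at `a = 1/4`, propagating along `a ↦ Ψ(a)` on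
`[1/4, 1/2)` and downward closed holds at EVERY `a < 1/2` — the endpoint `1/2` being the attracting fixed
point of `Ψ`. [folklore] -/
theorem all_lt_half_of_step {P : ℝ → Prop} (base : P (1 / 4))
    (step : ∀ a : ℝ, 1 / 4 ≤ a → a < 1 / 2 → P a → P ((5 + 2 * a) / (4 * (5 - 4 * a))))
    (mono : ∀ a b : ℝ, a ≤ b → P b → P a) :
    ∀ a : ℝ, a < 1 / 2 → P a := by
  intro a ha
  obtain ⟨n, hn⟩ := exists_pow_lt_of_lt_one (show (0 : ℝ) < 4 * (1 / 2 - a) by linarith)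
    (show (5 / 6 : ℝ) < 1 by norm_num)
  obtain ⟨b, -, -, hb3, hPb⟩ := iterate_psi base step n
  exact mono a b (by linarith) hPb

/-- Exponent monotonicity of a terminal power law: `D ≤ Cτ^a` near `T` ⟹ `D ≤ C'τ^{a'}` near `T` for
`a' ≤ a` (shrink the window to `τ ≤ 1`, constant `max C 0`). [folklore] -/
theorem powerLaw_mono {T : ℝ} {D : ℝ → ℝ} {a a' : ℝ} (haa' : a' ≤ a)
    (h : ∃ C T₂ : ℝ, T₂ < T ∧ ∀ t ∈ Ioo T₂ T, D t ≤ C * (T - t) ^ a) :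
    ∃ C T₂ : ℝ, T₂ < T ∧ ∀ t ∈ Ioo T₂ T, D t ≤ C * (T - t) ^ a' := by
  obtain ⟨C, T₂, hT₂, hC⟩ := h
  refine ⟨max C 0, max T₂ (T - 1), max_lt hT₂ (by linarith), fun t ht => ?_⟩
  have hT₂t : T₂ < t := lt_of_le_of_lt (le_max_left _ _) ht.1
  have ht1 : T - 1 < t := lt_of_le_of_lt (le_max_right _ _) ht.1
  have h0 : 0 < T - t := by linarith [ht.2]
  have h1 : T - t ≤ 1 := by linarith
  have hpow : (T - t) ^ a ≤ (T - t) ^ a' := Real.rpow_le_rpow_of_exponent_ge h0 h1 haa'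
  calc D t ≤ C * (T - t) ^ a := hC t ⟨hT₂t, ht.2⟩
    _ ≤ max C 0 * (T - t) ^ a := mul_le_mul_of_nonneg_right (le_max_left _ _) (Real.rpow_nonneg h0.le _)
    _ ≤ max C 0 * (T - t) ^ a' := mul_le_mul_of_nonneg_left hpow (le_max_right _ _)

end MeanFieldBootstrap

end Summit.NavierStokesRegularity.NavierStokesRegularity.Theorems
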